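import Summits.QuantumFields.YangMills.Theorems.UnitScaleTiltProp7LocalModelBlend
import Summits.QuantumFields.YangMills.Theorems.UnitScaleTiltProp7LemmaHCurvedOfRows
import HarnessLib

/-!
# Route `UnitScaleTilt`, crux K1 «MinimiserStabilityRegPr» (stmt-QuantumFields-19200), route-R E′ path (α′), row LEMMA-H-CURVED — FILE 9b (T³ letters, K-form-ready slack):
# LEMMA-H-CURVED WITH FREE LOCAL MODELS — the biharmonic Dirichlet principle fed with the blend `Σ_y W_y·Ψ_y` of ARBITRARY local models of the centre data; the slack
# is the local models' own covariant Laplacian ∕ Dirichlet energy near their centre, NOT a multiple of `Σ_y‖ψ̊(embIter y)‖²`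

Cell `ym3-torus`, D-0154 (3c) twin-width seat `ym-routeR-w1` (gen 6); row "routeR-w1: LEMMA-H-CURVED" (namer ★ym-ust-19200-p1 g14∕g15; design of record (x2′-corner)),
answering the namer's located objection to F-H5b (bus 2026-08-28 20:03Z).  THEOREMS ONLY (0 `def`, 0 `sorry`); `--supports stmt-QuantumFields-19200`, count-neutral.
YM₃ on T³ is a ladder rung (R3), not the Clay problem; nothing here claims a stub, the crux, d = 4 or the mass gap.

WHAT.  ✓ `Prop7LocalModelBlend.sum_sq_norm_lap_localBlend_le_supp` (F-H9a) instantiated on the fine torus with the C¹ cardinal weights of ✓ `Prop7HermiteCardinalWeights`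
(all weight rows discharged as in F-H5a ✓ `Prop7HermiteCornerBlendTorus`, plus the pointwise slope row `|∂_μW_y| ≤ 3∕ℓ` of §1), then F-H1 (✓ `Prop7CentreBiharmonicDirichlet`):
★★★ `lemmaH_curved_of_localModels` — run `K`, height `n`, `ℓ = L^(K−n) ≥ 2`, `SU(2)` background `W` read through `unitsField (toUField W)`, `𝔸 = M₂(ℂ)`; if
`Δ_W(Δ_Wψ) = 0` off the `(K−n)`-centres then, for ANY local models `Ψ_y : Site → 𝔸` with `Ψ_y(embIter y) = ψ(embIter y)` and ANY data row `‖Ψ_y(z) − Z_μ(z)‖ ≤ G_y` on the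
support predicate `N y z :⇔ ∀ ν, y_ν − Q_ν(z) ∈ {−1,0,1,2}` (`Q(z) = iterBlockOf (K−n) (z − (ℓ−1)∕2)`),
  `L^(K−n)·Σ_x‖Δ_Wψ(x)‖²_HS ≤ L^(K−n)·2·{ 3·Σ_yΣ_{x : N y x}‖Δ_WΨ_y(x)‖² + 3·(2d·(6∕ℓ))·(3∕ℓ)·Σ_yΣ_{x : N y x}Σ_μ(‖D*_WΨ_y(x,μ)‖² + ‖D_WΨ_y(x,μ)‖²) + 3d²(24∕ℓ²)((24∕ℓ²)ℓ^d)·Σ_yG_y² }`.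
READINGS.  (a) `Ψ_y := R(Fr_y ·)ψ(embIter y)` with (3.35)-type frame rows gives back the shape of ✓ `lemmaH_curved_of_rows` (the slack there = these two energies estimated by
`a₀`, `a₁` and `‖ψ(embIter y) − c_y‖`); (b) `Ψ_y :=` the `W`-parallel transport of `ψ(embIter y)` along coordinate combs (✓ `B10Eq27TorusAxialLog.axialT`) makes `D_WΨ_y` vanish
along the comb and equal a conjugated commutator `[hol_W(loop), ψ(embIter y)]` across it (✓ `holT_contourT`), and `Δ_WΨ_y` a sum of differences of such at adjacent bonds —
commutator currency, vanishing on aligned data — while `G_y` is a two-segment coarse covariant difference of centre values; (c) `Ψ_y := χ + R(Fr_y ·)(ψ − χ)(embIter y)` with ONE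
global fine field `χ` (e.g. a spectrally slow part of `ψ`, ✓ `Prop7SpectralSplit.exists_slow_fast_decomposition`; the namer's «slack(ψ_slow) + slack(ψ_fast)») charges `χ` only
through `Σ‖Δ_Wχ‖²` and its Dirichlet energy near the centres (multiplicity `≤ 4^d`), the framed remainder through reading (a), and `χ` drops out of the data row for the
recentring `Z_μ(z) := χ(z) + R(Fr_(Q z) z)(ψ − χ)(embIter (Q z))`.  The booking of the slack is the call site's (RULING g28-№2 (a)∕(e)); nothing is booked here.
HOW.  §1 the pointwise slope row of the weights; §2 the energy on the fine torus (generic `P`, `k`, offset `h`, profile rows displayed; NO hypothesis on the background `U`);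
§3 interpolation at the centres and the extension row; §4 the T³ assembly (profile rows by ✓ `Prop7LemmaHCurvedOfRows.profile_rows`, Frobenius ≤ `2·`operator², F-H1).
HONEST SCOPE.  Bookkeeping; the local models and the data row are the consumer's; nothing of Bałaban's is asserted; no stub∕crux∕rung statement is proved here.

References: T. Bałaban, CMP 99 (1985) 389–434 [Balaban1985BackgroundPropagators] ((3.3)-(3.4) pp.390-391, (3.35) p.396, Thm 3.11 p.416); CMP 95 (1984) 17–40
[Balaban1984PropagatorsI] ((1.18) p.20, (1.29)-(1.31) p.23); CMP 102 (1985) 277–309 [Balaban1985Variational] (Prop. 7 p.299).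
-/

set_option autoImplicit false

noncomputable section

open scoped BigOperators Matrix.Norms.L2Operator Matrix

namespace Summit.QuantumFields.YangMills.Theorems.Prop7LemmaHCurvedOfLocalModels

open Literature.MathematicalPhysics.QuantumFieldTheory.Balaban1983to89
open Literature.MathematicalPhysics.QuantumFieldTheory.Balaban1983to89.T3ContinuumYM3Torus
open B9Eq39Adjoint (R covD covDstar divB)
open B9TorusCalculus (torusT torusT_apply torusT_symm_apply)
open B10Eq27TorusAxialLog (unitsField toUField)
open B5Eq118OneStroke (iterBlockOf)
open B15DeterminingSets (embIter)
open Summit.QuantumFields.YangMills.Theorems.Prop7HermiteCardinalWeights (sum_weight_eq_one weight_nonneg weight_le_one weightE_nonneg weightE_le_one weight_embIter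
  abs_diff_weightE_le)
open Summit.QuantumFields.YangMills.Theorems.Prop7HermiteCardinalWeightsMass (diff_weight_eq)
open Summit.QuantumFields.YangMills.Theorems.Prop7HermiteCornerBlendTorus (weights_vanish_of_far mass_grad_row mass_second_row col_second_row)
open Summit.QuantumFields.YangMills.Theorems.Prop7LocalModelBlend (sum_sq_norm_lap_localBlend_le_supp)
open Summit.QuantumFields.YangMills.Theorems.Prop7LemmaHCurvedOfRows (profile_rows)
open Summit.QuantumFields.YangMills.Theorems.Prop7PinnedFlatCoercivity (sum_normSq_le_mul_opNorm_sq)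
open Summit.QuantumFields.YangMills.Theorems.Prop7CentreBiharmonicDirichlet (lap_energy_le_of_extension_T3)

variable {P : Params} {k : ℕ} (hk : k ≤ P.m + P.K) (h : ZMod (P.sitesPerDir 0)) (p : ℕ → ℝ)

/-! ## §1 The pointwise slope row of the cardinal weights -/

section Slope

include hk

/-- ★ **POINTWISE SLOPE ROW**: `|W_y(z + e_μ) − W_y(z)| ≤ 3∕ℓ` (the `μ`-factor moves by at most `3∕ℓ`, ✓ `abs_diff_weightE_le`; the other factors lie in `[0,1]`).
[cite: Balaban1984PropagatorsI, (1.29)-(1.31) p.23] -/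
theorem abs_diff_weight_le (hp0 : p 0 = 1) (hpℓ : p (P.L ^ k) = 0) (hp01 : ∀ r : ℕ, r < P.L ^ k → 0 ≤ p r ∧ p r ≤ 1)
    (hpS : ∀ r : ℕ, r + 1 ≤ P.L ^ k → |p (r + 1) - p r| ≤ 3 / (((P.L ^ k : ℕ) : ℝ))) (y : Site P k) (z : Site P 0) (μ : Fin P.d) :
    |(∏ ν : Fin P.d, (p (((torusT P 0 μ z) ν - h).val % P.L ^ k) * (if (iterBlockOf k (fun κ => (torusT P 0 μ z) κ - h)) ν = y ν then (1 : ℝ) else 0) + (1 - p (((torusT P 0 μ z) ν - h).val % P.L ^ k)) * (if (iterBlockOf k (fun κ => (torusT P 0 μ z) κ - h)) ν + 1 = y ν then (1 : ℝ) else 0))) - (∏ ν : Fin P.d, (p ((z ν - h).val % P.L ^ k) * (if (iterBlockOf k (fun κ => z κ - h)) ν = y ν then (1 : ℝ) else 0) + (1 - p ((z ν - h).val % P.L ^ k)) * (if (iterBlockOf k (fun κ => z κ - h)) ν + 1 = y ν then (1 : ℝ) else 0)))| ≤ 3 / (((P.L ^ k : ℕ) : ℝ)) := by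
  rw [torusT_apply, diff_weight_eq hk h p y μ z, abs_mul]
  have hprod0 : 0 ≤ ∏ ν ∈ Finset.univ.erase μ, (p ((z ν - h).val % P.L ^ k) * (if (iterBlockOf k (fun κ => z κ - h)) ν = y ν then (1 : ℝ) else 0) + (1 - p ((z ν - h).val % P.L ^ k)) * (if (iterBlockOf k (fun κ => z κ - h)) ν + 1 = y ν then (1 : ℝ) else 0)) :=
    Finset.prod_nonneg fun ν _ => weightE_nonneg h p hp01 ν (y ν) z
  have hprod1 : ∏ ν ∈ Finset.univ.erase μ, (p ((z ν - h).val % P.L ^ k) * (if (iterBlockOf k (fun κ => z κ - h)) ν = y ν then (1 : ℝ) else 0) + (1 - p ((z ν - h).val % P.L ^ k)) * (if (iterBlockOf k (fun κ => z κ - h)) ν + 1 = y ν then (1 : ℝ) else 0)) ≤ 1 :=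
    Finset.prod_le_one (fun ν _ => weightE_nonneg h p hp01 ν (y ν) z) (fun ν _ => weightE_le_one h p hp01 ν (y ν) z)
  rw [abs_of_nonneg hprod0]
  calc |(p (((z.shift μ) μ - h).val % P.L ^ k) * (if (iterBlockOf k (fun κ => (z.shift μ) κ - h)) μ = y μ then (1 : ℝ) else 0) + (1 - p (((z.shift μ) μ - h).val % P.L ^ k)) * (if (iterBlockOf k (fun κ => (z.shift μ) κ - h)) μ + 1 = y μ then (1 : ℝ) else 0)) - (p ((z μ - h).val % P.L ^ k) * (if (iterBlockOf k (fun κ => z κ - h)) μ = y μ then (1 : ℝ) else 0) + (1 - p ((z μ - h).val % P.L ^ k)) * (if (iterBlockOf k (fun κ => z κ - h)) μ + 1 = y μ then (1 : ℝ) else 0))|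
        * ∏ ν ∈ Finset.univ.erase μ, (p ((z ν - h).val % P.L ^ k) * (if (iterBlockOf k (fun κ => z κ - h)) ν = y ν then (1 : ℝ) else 0) + (1 - p ((z ν - h).val % P.L ^ k)) * (if (iterBlockOf k (fun κ => z κ - h)) ν + 1 = y ν then (1 : ℝ) else 0))
      ≤ 3 / (((P.L ^ k : ℕ) : ℝ)) * 1 := mul_le_mul (abs_diff_weightE_le hk h p hp0 hpℓ hpS μ (y μ) z) hprod1 hprod0 (by positivity)
    _ = 3 / (((P.L ^ k : ℕ) : ℝ)) := mul_one _

end Slope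

/-! ## §2 The energy of the local-model blend on the fine torus -/

section Energy

variable {𝔸 : Type} [NormedRing 𝔸] [NormedAlgebra ℝ 𝔸]

include hk

/-- ★★ **THE LOCAL-MODEL BLEND ENERGY ON THE FINE TORUS** (weights discharged; NO hypothesis on the background `U`; local models `Ψ_y` and data row `G` displayed on the support
predicate `∀ ν, y_ν − Q_ν(z) ∈ {−1,0,1,2}`):
`Σ_z‖Δ_UΦ(z)‖² ≤ 3·Σ_yΣ_{z : N y z}‖Δ_UΨ_y(z)‖² + 3·(2d(6∕ℓ))·(3∕ℓ)·Σ_yΣ_{z : N y z}Σ_μ(‖D*_UΨ_y(z,μ)‖² + ‖D_UΨ_y(z,μ)‖²) + 3d²(24∕ℓ²)((24∕ℓ²)ℓ^d)·Σ_yG_y²`.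
[cite: Balaban1985BackgroundPropagators, (3.3)-(3.4) pp.390-391, Thm 3.11 p.416; Balaban1984PropagatorsI, (1.29)-(1.31) p.23] -/
theorem sum_sq_norm_lap_localBlend_torus_le (hp0 : p 0 = 1) (hpℓ : p (P.L ^ k) = 0) (hp01 : ∀ r : ℕ, r < P.L ^ k → 0 ≤ p r ∧ p r ≤ 1)
    (hpS : ∀ r : ℕ, r + 1 ≤ P.L ^ k → |p (r + 1) - p r| ≤ 3 / (((P.L ^ k : ℕ) : ℝ)))
    (hpD : ∀ r : ℕ, 1 ≤ r → r + 1 ≤ P.L ^ k → |p (r + 1) - 2 * p r + p (r - 1)| ≤ 6 / (((P.L ^ k : ℕ) : ℝ)) ^ 2)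
    (hpc : p 1 + p (P.L ^ k - 1) = 1) (hpk : p (P.L ^ k - 1) ≤ 3 / (((P.L ^ k : ℕ) : ℝ)) ^ 2)
    (U : Fin P.d → Site P 0 → 𝔸ˣ) (Ψ : Site P k → Site P 0 → 𝔸) (Z : Fin P.d → Site P 0 → 𝔸) (G : Site P k → ℝ)
    (hG : ∀ (y : Site P k) (z : Site P 0), (∀ ν : Fin P.d, (y ν = (iterBlockOf k (fun κ => z κ - h)) ν - 1 ∨ y ν = (iterBlockOf k (fun κ => z κ - h)) ν ∨ y ν = (iterBlockOf k (fun κ => z κ - h)) ν + 1 ∨ y ν = (iterBlockOf k (fun κ => z κ - h)) ν + 2)) → ∀ μ : Fin P.d,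
      ‖Ψ y z - Z μ z‖ ≤ G y) :
    ∑ z : Site P 0, ‖divB (torusT P 0) U (fun μ => covD (torusT P 0) U μ (fun z' => ∑ y : Site P k, (∏ ν : Fin P.d, (p ((z' ν - h).val % P.L ^ k) * (if (iterBlockOf k (fun κ => z' κ - h)) ν = y ν then (1 : ℝ) else 0) + (1 - p ((z' ν - h).val % P.L ^ k)) * (if (iterBlockOf k (fun κ => z' κ - h)) ν + 1 = y ν then (1 : ℝ) else 0))) • Ψ y z')) z‖ ^ 2
      ≤ 3 * ∑ y : Site P k, ∑ z : Site P 0, (if (∀ ν : Fin P.d, (y ν = (iterBlockOf k (fun κ => z κ - h)) ν - 1 ∨ y ν = (iterBlockOf k (fun κ => z κ - h)) ν ∨ y ν = (iterBlockOf k (fun κ => z κ - h)) ν + 1 ∨ y ν = (iterBlockOf k (fun κ => z κ - h)) ν + 2))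
            then ‖divB (torusT P 0) U (fun μ => covD (torusT P 0) U μ (Ψ y)) z‖ ^ 2 else 0)
        + 3 * (2 * (P.d : ℝ) * (6 / (((P.L ^ k : ℕ) : ℝ)))) * (3 / (((P.L ^ k : ℕ) : ℝ)))
          * ∑ y : Site P k, ∑ z : Site P 0, (if (∀ ν : Fin P.d, (y ν = (iterBlockOf k (fun κ => z κ - h)) ν - 1 ∨ y ν = (iterBlockOf k (fun κ => z κ - h)) ν ∨ y ν = (iterBlockOf k (fun κ => z κ - h)) ν + 1 ∨ y ν = (iterBlockOf k (fun κ => z κ - h)) ν + 2))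
            then ∑ μ : Fin P.d, (‖covDstar (torusT P 0) U μ (Ψ y) z‖ ^ 2 + ‖covD (torusT P 0) U μ (Ψ y) z‖ ^ 2) else 0)
        + 3 * (P.d : ℝ) ^ 2 * (24 / (((P.L ^ k : ℕ) : ℝ)) ^ 2) * (24 / (((P.L ^ k : ℕ) : ℝ)) ^ 2 * (((P.L ^ k : ℕ) : ℝ)) ^ P.d) * ∑ y : Site P k, G y ^ 2 := by
  have hW1 : ∀ z : Site P 0, ∑ y : Site P k, (∏ ν : Fin P.d, (p ((z ν - h).val % P.L ^ k) * (if (iterBlockOf k (fun κ => z κ - h)) ν = y ν then (1 : ℝ) else 0) + (1 - p ((z ν - h).val % P.L ^ k)) * (if (iterBlockOf k (fun κ => z κ - h)) ν + 1 = y ν then (1 : ℝ) else 0))) = 1 := fun z => sum_weight_eq_one h p z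
  have hW0 : ∀ (y : Site P k) (z : Site P 0), 0 ≤ (∏ ν : Fin P.d, (p ((z ν - h).val % P.L ^ k) * (if (iterBlockOf k (fun κ => z κ - h)) ν = y ν then (1 : ℝ) else 0) + (1 - p ((z ν - h).val % P.L ^ k)) * (if (iterBlockOf k (fun κ => z κ - h)) ν + 1 = y ν then (1 : ℝ) else 0))) := fun y z => weight_nonneg h p hp01 y z
  have hWle : ∀ (y : Site P k) (z : Site P 0), (∏ ν : Fin P.d, (p ((z ν - h).val % P.L ^ k) * (if (iterBlockOf k (fun κ => z κ - h)) ν = y ν then (1 : ℝ) else 0) + (1 - p ((z ν - h).val % P.L ^ k)) * (if (iterBlockOf k (fun κ => z κ - h)) ν + 1 = y ν then (1 : ℝ) else 0))) ≤ 1 := fun y z => weight_le_one h p hp01 y z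
  have hN : ∀ (y : Site P k) (z : Site P 0), ¬ (∀ ν : Fin P.d, (y ν = (iterBlockOf k (fun κ => z κ - h)) ν - 1 ∨ y ν = (iterBlockOf k (fun κ => z κ - h)) ν ∨ y ν = (iterBlockOf k (fun κ => z κ - h)) ν + 1 ∨ y ν = (iterBlockOf k (fun κ => z κ - h)) ν + 2)) →
      (∏ ν : Fin P.d, (p ((z ν - h).val % P.L ^ k) * (if (iterBlockOf k (fun κ => z κ - h)) ν = y ν then (1 : ℝ) else 0) + (1 - p ((z ν - h).val % P.L ^ k)) * (if (iterBlockOf k (fun κ => z κ - h)) ν + 1 = y ν then (1 : ℝ) else 0))) = 0 ∧ (∀ μ : Fin P.d, (∏ ν : Fin P.d, (p (((torusT P 0 μ z) ν - h).val % P.L ^ k) * (if (iterBlockOf k (fun κ => (torusT P 0 μ z) κ - h)) ν = y ν then (1 : ℝ) else 0) + (1 - p (((torusT P 0 μ z) ν - h).val % P.L ^ k)) * (if (iterBlockOf k (fun κ => (torusT P 0 μ z) κ - h)) ν + 1 = y ν then (1 : ℝ) else 0))) = 0) ∧ (∀ μ : Fin P.d, (∏ ν : Fin P.d, (p ((((torusT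 P 0 μ).symm z) ν - h).val % P.L ^ k) * (if (iterBlockOf k (fun κ => ((torusT P 0 μ).symm z) κ - h)) ν = y ν then (1 : ℝ) else 0) + (1 - p ((((torusT P 0 μ).symm z) ν - h).val % P.L ^ k)) * (if (iterBlockOf k (fun κ => ((torusT P 0 μ).symm z) κ - h)) ν + 1 = y ν then (1 : ℝ) else 0))) = 0) := fun y z hfar => weights_vanish_of_far hk h p y z hfar
  have hg₁ := abs_diff_weight_le hk h p hp0 hpℓ hp01 hpS
  have hM1 := mass_grad_row hk h p hp0 hpℓ hp01 hpS
  have hM2 := mass_second_row hk h p hp0 hpℓ hp01 hpD hpc hpk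
  have hK2 := col_second_row hk h p hp0 hpℓ hp01 hpD hpc hpk
  have hG₁ : (0 : ℝ) ≤ 6 / (((P.L ^ k : ℕ) : ℝ)) := by positivity
  have hG₂ : (0 : ℝ) ≤ 24 / (((P.L ^ k : ℕ) : ℝ)) ^ 2 := by positivity
  have hmain := sum_sq_norm_lap_localBlend_le_supp (Y := Site P k) (torusT P 0) U (fun y z => (∏ ν : Fin P.d, (p ((z ν - h).val % P.L ^ k) * (if (iterBlockOf k (fun κ => z κ - h)) ν = y ν then (1 : ℝ) else 0) + (1 - p ((z ν - h).val % P.L ^ k)) * (if (iterBlockOf k (fun κ => z κ - h)) ν + 1 = y ν then (1 : ℝ) else 0)))) hW1 hW0 hWle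
    Ψ (fun y z => ∀ ν : Fin P.d, (y ν = (iterBlockOf k (fun κ => z κ - h)) ν - 1 ∨ y ν = (iterBlockOf k (fun κ => z κ - h)) ν ∨ y ν = (iterBlockOf k (fun κ => z κ - h)) ν + 1 ∨ y ν = (iterBlockOf k (fun κ => z κ - h)) ν + 2))
    hN Z G hG _ _ _ _ hG₁ hG₂ hg₁ hM1 hM2 hK2
  rw [Fintype.card_fin] at hmain
  exact hmain

end Energy

/-! ## §3 Interpolation at the centres (offset `h = (ℓ−1)∕2`) and the extension row -/

section Centre

variable {𝔸 : Type} [NormedRing 𝔸] [NormedAlgebra ℝ 𝔸]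

include hk

omit h in
/-- ★ **THE BLEND INTERPOLATES**: `Φ(embIter y) = Ψ_y(embIter y)` (cardinal weights: `W_(y′)(embIter y) = δ_(y y′)`, ✓ `weight_embIter`). [cite: Balaban1984PropagatorsI, (1.18) p.20] -/
theorem localBlend_embIter (hp0 : p 0 = 1) (Ψ : Site P k → Site P 0 → 𝔸) (y : Site P k) :
    ∑ y' : Site P k, (∏ ν : Fin P.d, (p (((embIter k y) ν - ((((P.L ^ k - 1) / 2 : ℕ)) : ZMod (P.sitesPerDir 0))).val % P.L ^ k) * (if (iterBlockOf k (fun κ => (embIter k y) κ - ((((P.L ^ k - 1) / 2 : ℕ)) : ZMod (P.sitesPerDir 0)))) ν = y' ν then (1 : ℝ) else 0) + (1 - p (((embIter k y) ν - ((((P.L ^ k - 1) / 2 : ℕ)) : ZMod (P.sitesPerDir 0))).val % P.L ^ k)) * (if (iterBlockOf k (fun κ => (embIter k y) κ - ((((P.L ^ k - 1) / 2 : ℕ)) : ZMod (P.sitesPerDir 0)))) ν + 1 = y' ν then (1 : ℝ) else 0))) • Ψ y' (embIter k y) = Ψ y (embIter k y) := by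
  have hw : ∀ y' : Site P k, (∏ ν : Fin P.d, (p (((embIter k y) ν - ((((P.L ^ k - 1) / 2 : ℕ)) : ZMod (P.sitesPerDir 0))).val % P.L ^ k) * (if (iterBlockOf k (fun κ => (embIter k y) κ - ((((P.L ^ k - 1) / 2 : ℕ)) : ZMod (P.sitesPerDir 0)))) ν = y' ν then (1 : ℝ) else 0) + (1 - p (((embIter k y) ν - ((((P.L ^ k - 1) / 2 : ℕ)) : ZMod (P.sitesPerDir 0))).val % P.L ^ k)) * (if (iterBlockOf k (fun κ => (embIter k y) κ - ((((P.L ^ k - 1) / 2 : ℕ)) : ZMod (P.sitesPerDir 0)))) ν + 1 = y' ν then (1 : ℝ) else 0))) = if y = y' then (1 : ℝ) else 0 := fun y' => weight_embIter hk p hp0 y' y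
  simp only [hw, ite_smul, one_smul, zero_smul, Finset.sum_ite_eq, Finset.mem_univ, if_true]

omit h in
/-- ★★ **THE EXTENSION ROW FOR LEMMA-H-CURVED WITH FREE LOCAL MODELS**: an extension `Φ` of the centre data `m` with the displayed Laplacian energy exists (the local-model
blend at offset `h = (ℓ−1)∕2`), for ANY local models `Ψ_y` with `Ψ_y(embIter y) = m_y` and ANY data row `G` on the support predicate; the slack is the local models' own
covariant energy on the support. [cite: Balaban1985BackgroundPropagators, (3.3)-(3.4) pp.390-391, Thm 3.11 p.416; Balaban1984PropagatorsI, (1.29)-(1.31) p.23] -/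
theorem exists_localExtension_lap_energy_le (hp0 : p 0 = 1) (hpℓ : p (P.L ^ k) = 0) (hp01 : ∀ r : ℕ, r < P.L ^ k → 0 ≤ p r ∧ p r ≤ 1)
    (hpS : ∀ r : ℕ, r + 1 ≤ P.L ^ k → |p (r + 1) - p r| ≤ 3 / (((P.L ^ k : ℕ) : ℝ)))
    (hpD : ∀ r : ℕ, 1 ≤ r → r + 1 ≤ P.L ^ k → |p (r + 1) - 2 * p r + p (r - 1)| ≤ 6 / (((P.L ^ k : ℕ) : ℝ)) ^ 2)
    (hpc : p 1 + p (P.L ^ k - 1) = 1) (hpk : p (P.L ^ k - 1) ≤ 3 / (((P.L ^ k : ℕ) : ℝ)) ^ 2)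
    (U : Fin P.d → Site P 0 → 𝔸ˣ) (m : Site P k → 𝔸) (Ψ : Site P k → Site P 0 → 𝔸) (hΨ : ∀ y : Site P k, Ψ y (embIter k y) = m y)
    (Z : Fin P.d → Site P 0 → 𝔸) (G : Site P k → ℝ)
    (hG : ∀ (y : Site P k) (z : Site P 0), (∀ ν : Fin P.d, (y ν = (iterBlockOf k (fun κ => z κ - ((((P.L ^ k - 1) / 2 : ℕ)) : ZMod (P.sitesPerDir 0)))) ν - 1 ∨ y ν = (iterBlockOf k (fun κ => z κ - ((((P.L ^ k - 1) / 2 : ℕ)) : ZMod (P.sitesPerDir 0)))) ν ∨ y ν = (iterBlockOf k (fun κ => z κ - ((((P.L ^ k - 1) / 2 : ℕ)) : ZMod (P.sitesPerDir 0)))) ν + 1 ∨ y ν = (iterBlockOf k (fun κ => z κ - ((((P.L ^ k - 1) / 2 : ℕ)) : ZMod (P.sitesPerDir 0)))) ν + 2)) → ∀ μ : Fin P.d,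
      ‖Ψ y z - Z μ z‖ ≤ G y) :
    ∃ Φ : Site P 0 → 𝔸, (∀ y : Site P k, Φ (embIter k y) = m y) ∧
      ∑ z : Site P 0, ‖divB (torusT P 0) U (fun μ => covD (torusT P 0) U μ Φ) z‖ ^ 2
        ≤ 3 * ∑ y : Site P k, ∑ z : Site P 0, (if (∀ ν : Fin P.d, (y ν = (iterBlockOf k (fun κ => z κ - ((((P.L ^ k - 1) / 2 : ℕ)) : ZMod (P.sitesPerDir 0)))) ν - 1 ∨ y ν = (iterBlockOf k (fun κ => z κ - ((((P.L ^ k - 1) / 2 : ℕ)) : ZMod (P.sitesPerDir 0)))) ν ∨ y ν = (iterBlockOf k (fun κ => z κ - ((((P.L ^ k - 1) / 2 : ℕ)) : ZMod (P.sitesPerDir 0)))) ν + 1 ∨ y ν = (iterBlockOf k (fun κ => z κ - ((((P.L ^ k - 1) / 2 : ℕ)) : ZMod (P.sitesPerDir 0)))) ν + 2))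
              then ‖divB (torusT P 0) U (fun μ => covD (torusT P 0) U μ (Ψ y)) z‖ ^ 2 else 0)
          + 3 * (2 * (P.d : ℝ) * (6 / (((P.L ^ k : ℕ) : ℝ)))) * (3 / (((P.L ^ k : ℕ) : ℝ)))
            * ∑ y : Site P k, ∑ z : Site P 0, (if (∀ ν : Fin P.d, (y ν = (iterBlockOf k (fun κ => z κ - ((((P.L ^ k - 1) / 2 : ℕ)) : ZMod (P.sitesPerDir 0)))) ν - 1 ∨ y ν = (iterBlockOf k (fun κ => z κ - ((((P.L ^ k - 1) / 2 : ℕ)) : ZMod (P.sitesPerDir 0)))) ν ∨ y ν = (iterBlockOf k (fun κ => z κ - ((((P.L ^ k - 1) / 2 : ℕ)) : ZMod (P.sitesPerDir 0)))) ν + 1 ∨ y ν = (iterBlockOf k (fun κ => z κ - ((((P.L ^ k - 1) / 2 : ℕ)) : ZMod (P.sitesPerDir 0)))) ν + 2))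
              then ∑ μ : Fin P.d, (‖covDstar (torusT P 0) U μ (Ψ y) z‖ ^ 2 + ‖covD (torusT P 0) U μ (Ψ y) z‖ ^ 2) else 0)
          + 3 * (P.d : ℝ) ^ 2 * (24 / (((P.L ^ k : ℕ) : ℝ)) ^ 2) * (24 / (((P.L ^ k : ℕ) : ℝ)) ^ 2 * (((P.L ^ k : ℕ) : ℝ)) ^ P.d) * ∑ y : Site P k, G y ^ 2 :=
  ⟨fun z' => ∑ y : Site P k, (∏ ν : Fin P.d, (p ((z' ν - ((((P.L ^ k - 1) / 2 : ℕ)) : ZMod (P.sitesPerDir 0))).val % P.L ^ k) * (if (iterBlockOf k (fun κ => z' κ - ((((P.L ^ k - 1) / 2 : ℕ)) : ZMod (P.sitesPerDir 0)))) ν = y ν then (1 : ℝ) else 0) + (1 - p ((z' ν - ((((P.L ^ k - 1) / 2 : ℕ)) : ZMod (P.sitesPerDir 0))).val % P.L ^ k)) * (if (iterBlockOf k (fun κ => z' κ - ((((P.L ^ k - 1) / 2 : ℕ)) : ZMod (P.sitesPerDir 0)))) ν + 1 = y ν then (1 : ℝ) else 0))) • Ψ y z',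
    fun y => (localBlend_embIter hk p hp0 Ψ y).trans (hΨ y),
    sum_sq_norm_lap_localBlend_torus_le hk ((((P.L ^ k - 1) / 2 : ℕ)) : ZMod (P.sitesPerDir 0)) p hp0 hpℓ hp01 hpS hpD hpc hpk U Ψ Z G hG⟩

end Centre

/-! ## §4 LEMMA-H-curved with free local models (T³ letters) -/

section Assembly

/-- ★★★ **LEMMA-H-CURVED WITH FREE LOCAL MODELS** (T³ letters; see the module docstring): if `Δ_W(Δ_Wψ) = 0` off the `(K−n)`-centres then, for ANY local models `Ψ_y` of
the centre data (`Ψ_y(embIter y) = ψ(embIter y)`) and ANY data row `G` on the support predicate, `L^(K−n)·Σ_x‖Δ_Wψ(x)‖²_HS` is at most `L^(K−n)·2·{` the supported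
covariant Laplacian energy of the `Ψ_y` (× 3) `+` the supported covariant Dirichlet energy of the `Ψ_y` (× `3·(2d·6∕ℓ)·(3∕ℓ)`) `+ 3d²(24∕ℓ²)((24∕ℓ²)ℓ^d)·Σ_yG_y² }`.
[cite: Balaban1985BackgroundPropagators, (3.3)-(3.4) pp.390-391, Thm 3.11 p.416; Balaban1984PropagatorsI, (1.29)-(1.31) p.23; Balaban1985Variational, Prop. 7 p.299] -/
theorem lemmaH_curved_of_localModels (F : T3Family) (K n : ℕ) (hk : K - n ≤ (F.P K).m + (F.P K).K) (hℓ2 : 2 ≤ (F.P K).L ^ (K - n))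
    (W : GaugeField (F.P K) 0 (Matrix.specialUnitaryGroup (Fin 2) ℂ)) (ψ : Site (F.P K) 0 → Matrix (Fin 2) (Fin 2) ℂ)
    (hψ : ∀ x : Site (F.P K) 0, x ∉ Set.range (embIter (K - n)) →
      divB (torusT (F.P K) 0) (fun κ z => unitsField (toUField W) ⟨z, κ⟩) (fun κ y => covD (torusT (F.P K) 0) (fun κ z => unitsField (toUField W) ⟨z, κ⟩) κ
        (fun z => divB (torusT (F.P K) 0) (fun κ z => unitsField (toUField W) ⟨z, κ⟩)
          (fun ν w => covD (torusT (F.P K) 0) (fun κ z => unitsField (toUField W) ⟨z, κ⟩) ν ψ w) z) y) x = 0)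
    (Ψ : Site (F.P K) (K - n) → Site (F.P K) 0 → Matrix (Fin 2) (Fin 2) ℂ) (hΨ : ∀ y, Ψ y (embIter (K - n) y) = ψ (embIter (K - n) y))
    (Z : Fin (F.P K).d → Site (F.P K) 0 → Matrix (Fin 2) (Fin 2) ℂ) (G : Site (F.P K) (K - n) → ℝ)
    (hG : ∀ (y : Site (F.P K) (K - n)) (z : Site (F.P K) 0),
      (∀ ν : Fin (F.P K).d,
        (y ν = (iterBlockOf (K - n) (fun κ => z κ - (((((F.P K).L ^ (K - n) - 1) / 2 : ℕ)) : ZMod ((F.P K).sitesPerDir 0)))) ν - 1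
        ∨ y ν = (iterBlockOf (K - n) (fun κ => z κ - (((((F.P K).L ^ (K - n) - 1) / 2 : ℕ)) : ZMod ((F.P K).sitesPerDir 0)))) ν
        ∨ y ν = (iterBlockOf (K - n) (fun κ => z κ - (((((F.P K).L ^ (K - n) - 1) / 2 : ℕ)) : ZMod ((F.P K).sitesPerDir 0)))) ν + 1
        ∨ y ν = (iterBlockOf (K - n) (fun κ => z κ - (((((F.P K).L ^ (K - n) - 1) / 2 : ℕ)) : ZMod ((F.P K).sitesPerDir 0)))) ν + 2)) →
      ∀ μ : Fin (F.P K).d, ‖Ψ y z - Z μ z‖ ≤ G y) :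
    (F.L : ℝ) ^ (K - n) * ∑ x : Site (F.P K) 0, ∑ a : Fin 2, ∑ b : Fin 2,
        Complex.normSq ((divB (torusT (F.P K) 0) (fun κ z => unitsField (toUField W) ⟨z, κ⟩)
          (fun κ y => covD (torusT (F.P K) 0) (fun κ z => unitsField (toUField W) ⟨z, κ⟩) κ ψ y) x) a b)
      ≤ (F.L : ℝ) ^ (K - n) * (2 * (
          3 * ∑ y : Site (F.P K) (K - n), ∑ z : Site (F.P K) 0,
            (if (∀ ν : Fin (F.P K).d,
                (y ν = (iterBlockOf (K - n) (fun κ => z κ - (((((F.P K).L ^ (K - n) - 1) / 2 : ℕ)) : ZMod ((F.P K).sitesPerDir 0)))) ν - 1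
                ∨ y ν = (iterBlockOf (K - n) (fun κ => z κ - (((((F.P K).L ^ (K - n) - 1) / 2 : ℕ)) : ZMod ((F.P K).sitesPerDir 0)))) ν
                ∨ y ν = (iterBlockOf (K - n) (fun κ => z κ - (((((F.P K).L ^ (K - n) - 1) / 2 : ℕ)) : ZMod ((F.P K).sitesPerDir 0)))) ν + 1
                ∨ y ν = (iterBlockOf (K - n) (fun κ => z κ - (((((F.P K).L ^ (K - n) - 1) / 2 : ℕ)) : ZMod ((F.P K).sitesPerDir 0)))) ν + 2))
              then ‖divB (torusT (F.P K) 0) (fun κ z => unitsField (toUField W) ⟨z, κ⟩)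
                (fun μ => covD (torusT (F.P K) 0) (fun κ z => unitsField (toUField W) ⟨z, κ⟩) μ (Ψ y)) z‖ ^ 2 else 0)
          + 3 * (2 * ((F.P K).d : ℝ) * (6 / ((((F.P K).L ^ (K - n) : ℕ) : ℝ)))) * (3 / ((((F.P K).L ^ (K - n) : ℕ) : ℝ)))
            * ∑ y : Site (F.P K) (K - n), ∑ z : Site (F.P K) 0,
              (if (∀ ν : Fin (F.P K).d,
                  (y ν = (iterBlockOf (K - n) (fun κ => z κ - (((((F.P K).L ^ (K - n) - 1) / 2 : ℕ)) : ZMod ((F.P K).sitesPerDir 0)))) ν - 1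
                  ∨ y ν = (iterBlockOf (K - n) (fun κ => z κ - (((((F.P K).L ^ (K - n) - 1) / 2 : ℕ)) : ZMod ((F.P K).sitesPerDir 0)))) ν
                  ∨ y ν = (iterBlockOf (K - n) (fun κ => z κ - (((((F.P K).L ^ (K - n) - 1) / 2 : ℕ)) : ZMod ((F.P K).sitesPerDir 0)))) ν + 1
                  ∨ y ν = (iterBlockOf (K - n) (fun κ => z κ - (((((F.P K).L ^ (K - n) - 1) / 2 : ℕ)) : ZMod ((F.P K).sitesPerDir 0)))) ν + 2))
                then ∑ μ : Fin (F.P K).d,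
                  (‖covDstar (torusT (F.P K) 0) (fun κ z => unitsField (toUField W) ⟨z, κ⟩) μ (Ψ y) z‖ ^ 2
                    + ‖covD (torusT (F.P K) 0) (fun κ z => unitsField (toUField W) ⟨z, κ⟩) μ (Ψ y) z‖ ^ 2) else 0)
          + 3 * ((F.P K).d : ℝ) ^ 2 * (24 / ((((F.P K).L ^ (K - n) : ℕ) : ℝ)) ^ 2)
            * (24 / ((((F.P K).L ^ (K - n) : ℕ) : ℝ)) ^ 2 * ((((F.P K).L ^ (K - n) : ℕ) : ℝ)) ^ (F.P K).d) * ∑ y : Site (F.P K) (K - n), G y ^ 2)) := by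
  obtain ⟨hp0, hpℓ, hp01, hpS, hpD, hpc, hpk⟩ := profile_rows (P := F.P K) (k := K - n) hℓ2
  obtain ⟨Φ, hΦ, hE⟩ := exists_localExtension_lap_energy_le (P := F.P K) (k := K - n) hk _ hp0 hpℓ hp01 hpS hpD hpc hpk
    (fun κ z => unitsField (toUField W) ⟨z, κ⟩) (fun y => ψ (embIter (K - n) y)) Ψ hΨ Z G hG
  refine lap_energy_le_of_extension_T3 F K n W ψ hψ ⟨Φ, hΦ, mul_le_mul_of_nonneg_left ?_ (by positivity)⟩
  calc ∑ x : Site (F.P K) 0, ∑ a : Fin 2, ∑ b : Fin 2, Complex.normSq ((divB (torusT (F.P K) 0) (fun κ z => unitsField (toUField W) ⟨z, κ⟩)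
          (fun κ y => covD (torusT (F.P K) 0) (fun κ z => unitsField (toUField W) ⟨z, κ⟩) κ Φ y) x) a b)
      ≤ ∑ x : Site (F.P K) 0, (2 : ℕ) * ‖divB (torusT (F.P K) 0) (fun κ z => unitsField (toUField W) ⟨z, κ⟩)
          (fun κ y => covD (torusT (F.P K) 0) (fun κ z => unitsField (toUField W) ⟨z, κ⟩) κ Φ y) x‖ ^ 2 :=
        Finset.sum_le_sum fun x _ => sum_normSq_le_mul_opNorm_sq _
    _ = 2 * ∑ x : Site (F.P K) 0, ‖divB (torusT (F.P K) 0) (fun κ z => unitsField (toUField W) ⟨z, κ⟩)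
          (fun μ => covD (torusT (F.P K) 0) (fun κ z => unitsField (toUField W) ⟨z, κ⟩) μ Φ) x‖ ^ 2 := by
        rw [Finset.mul_sum]; push_cast; rfl
    _ ≤ _ := mul_le_mul_of_nonneg_left hE (by norm_num)

end Assembly

end Summit.QuantumFields.YangMills.Theorems.Prop7LemmaHCurvedOfLocalModels

end
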